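import Mathlib

/-!
# `NormalFormPrinciple` (stmt-KontsevichZagierPeriods-3869), line `SketchIdeator1` — the leaf
# `stub_boxRigidity` in dimension two, level two: the arithmetic rigidity of the normal form

Stub `levelTwo_rigid_numbers` of wave 3 (lead seat c7). The level-two family
`[(0,1)², P(x,y)/(1 − x²y²)]` reduces by Kontsevich–Zagier moves to the normal form
`β[(0,1)², 1/(1 − x²y²)] + γ[(1,2), 1/y] + [pt, q]` with value `β·π²/8 + γ·log 2 + q`; this file
compares coefficients under the (open) `ℚ`-linear independence of `1, π², log 2`.
Reference: M. Kontsevich, D. Zagier, *Periods* (2001), §1.2. No definitions are introduced.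
-/

namespace Summit.KontsevichZagierPeriods.HurwitzMicroSectors.NormalFormPrinciple.PiBox.LevelN

/-- **Rigidity of the level-two normal form**: if `1, π², log 2` are `ℚ`-linearly independent then
`β·π²/8 + γ·log 2 + q = β'·π²/8 + γ'·log 2 + q'` forces `(β, γ, q) = (β', γ', q')`.
[cite: KontsevichZagier2001, §1.2] -/
theorem levelTwo_rigid_numbers (h : LinearIndependent ℚ ![(1:ℝ), Real.pi ^ 2, Real.log 2])
    (β γ q β' γ' q' : ℚ)
    (he : (β : ℝ) * (Real.pi ^ 2 / 8) + (γ : ℝ) * Real.log 2 + q =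
      (β' : ℝ) * (Real.pi ^ 2 / 8) + (γ' : ℝ) * Real.log 2 + q') :
    β = β' ∧ γ = γ' ∧ q = q' := by
  rw [Fintype.linearIndependent_iff] at h
  have key := h ![q - q', (β - β') / 8, γ - γ'] (by
    rw [Fin.sum_univ_three]
    simp only [Matrix.cons_val_zero, Matrix.cons_val_one, Matrix.cons_val_two, Matrix.tail_cons,
      Matrix.head_cons, Rat.smul_def]
    push_cast
    linarith)
  have h0 := key 0
  have h1 := key 1
  have h2 := key 2
  simp only [Matrix.cons_val_zero, Matrix.cons_val_one, Matrix.cons_val_two, Matrix.tail_cons,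
    Matrix.head_cons, div_eq_zero_iff, OfNat.ofNat_ne_zero, or_false] at h0 h1 h2
  exact ⟨by linarith, by linarith, by linarith⟩

end Summit.KontsevichZagierPeriods.HurwitzMicroSectors.NormalFormPrinciple.PiBox.LevelN
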